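import Literature.Analysis.FluidPDE.NewtonPotential
import Literature.Analysis.FluidPDE.WholeSpaceIBP
import Literature.Analysis.PDE.SemilinearHeatHolderTools
import HarnessLib

/-!
# CoriolisHeadFarFieldShellMean — crux `NoCoRotatingCore` (stmt-NavierStokesRegularity-22676), line
# `far_field_constancy` v2 (skeleton 15c9a82ad206abb9), stub K1b `stub_farFieldLimit`: the SHELL-MEAN LEMMA for a gradient

Generic potential theory on `ℝ³` used by K1b (`bounded + scale-natural decay ⇒ U → b`).  For a smooth `P : ℝ³ → ℝ`
and a direction `e`, the dyadic shell means of `∂ₑP` against the mass-one radial weight `λ^{R,2R} = Δ((1 − θ_{R,2R})Γ)` of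
the tree (`newtonFarLaplacian`, supported in `R ≤ |z| ≤ 2R`, `∫ λ = 1`, `∫ |λ^{R,2R}| = ∫ |λ^{1,2}|`) satisfy the
TELESCOPING IDENTITY (Green's second identity for the smooth compactly supported kernel `K_R = Γ∞^{R,2R} − Γ∞^{2R,4R}`)

  `∫ λ^{R,2R} ∂ₑP − ∫ λ^{2R,4R} ∂ₑP = ∫ K_R Δ(∂ₑP) = −∫ ∂ₑK_R · ΔP`,

and `|∂ₑK_R(z)| ≤ 2C_Γ/R²` (scaling: `Γ∞^{R,2R}(z) = R⁻¹Γ∞^{1,2}(z/R)`), `K_R` lives in `R ≤ |z| ≤ 4R`.  Hence, if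
`|ΔP(z)| ≤ K/|z|²` for `|z| ≥ R₁`, then `|∫ λ^{R,2R} ∂ₑP − ∫ λ^{2R,4R} ∂ₑP| ≤ C·K/R` (`shellMean_sub_shellMean_le`): the dyadic shell
means form a Cauchy sequence although `∂ₑP` itself is only known to be bounded — this is the step that rules out slowly varying,
non-convergent far fields (for them `ΔP` is not `O(|z|⁻²)`).  Companion: `abs_shellMean_sub_le` — the shell mean differs from any
value by at most `(∫|λ^{1,2}|) ×` the oscillation on the shell.

WHAT THIS IS NOT: pure analysis; nothing about `NoCoRotatingCore`, Pineau–Vicol's conjecture or NS regularity is proved here.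
[cite: GilbargTrudinger2001, (2.17) (Green representation); Tsai1998 §3 (pressure of a Leray profile)]
-/

noncomputable section

open MeasureTheory Set Function Filter Topology Metric InnerProductSpace Real
open scoped RealInnerProductSpace Laplacian ContDiff

set_option linter.dupNamespace false

namespace Summit.NavierStokesRegularity.NavierStokesRegularity.Theorems.CoriolisHead

open Literature.Analysis.FluidPDE

/-! ## §1 The far kernel `Γ∞^{R,2R}`: a scale-free derivative bound -/

/-- `|w|² ‖DΓ∞^{1,2}(w)‖ ≤ C_Γ` for all `w` (on `|w| ≤ 2` by compactness, beyond by `Γ∞ = Γ` and `‖DΓ(w)‖ = (4π|w|²)⁻¹`). -/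
theorem exists_sq_mul_norm_fderiv_newtonFar_le :
    ∃ C : ℝ, 0 ≤ C ∧ ∀ w : (EuclideanSpace ℝ (Fin 3)), ‖w‖ ^ 2 * ‖fderiv ℝ (newtonFar 1 2) w‖ ≤ C := by
  have hsm : ContDiff ℝ 1 (newtonFar 1 2) := contDiff_newtonFar one_pos one_lt_two
  have hc : Continuous fun w : (EuclideanSpace ℝ (Fin 3)) => ‖w‖ ^ 2 * ‖fderiv ℝ (newtonFar 1 2) w‖ :=
    (continuous_norm.pow 2).mul (hsm.continuous_fderiv one_ne_zero).norm
  obtain ⟨B, hB⟩ := (isCompact_closedBall (0 : (EuclideanSpace ℝ (Fin 3))) 2).exists_bound_of_continuousOn hc.continuousOn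
  refine ⟨max B (4 * π)⁻¹, le_max_of_le_right (by positivity), fun w => ?_⟩
  by_cases hw : ‖w‖ ≤ 2
  · have h := hB w (mem_closedBall_zero_iff.2 hw)
    rw [Real.norm_of_nonneg (by positivity)] at h
    exact h.trans (le_max_left _ _)
  · rw [not_le] at hw
    have hw0 : w ≠ 0 := by
      rintro rfl
      rw [norm_zero] at hw
      linarith
    have hev : newtonFar 1 2 =ᶠ[𝓝 w] newtonKernel := by
      have hopen : IsOpen {z : (EuclideanSpace ℝ (Fin 3)) | 2 < ‖z‖} := isOpen_lt continuous_const continuous_norm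
      filter_upwards [hopen.mem_nhds hw] with z hz
      exact newtonFar_eq_newtonKernel zero_le_one one_lt_two (le_of_lt hz)
    rw [hev.fderiv_eq, norm_fderiv_newtonKernel hw0]
    have hwpos : 0 < ‖w‖ := norm_pos_iff.2 hw0
    have : ‖w‖ ^ 2 * (4 * π * ‖w‖ ^ 2)⁻¹ = (4 * π)⁻¹ := by
      field_simp
    rw [this]
    exact le_max_right _ _

/-- Scaling of the bound: `|z|² ‖DΓ∞^{R,2R}(z)‖ ≤ C_Γ` for every `R > 0` (`Γ∞^{R,2R}(z) = R⁻¹ Γ∞^{1,2}(R⁻¹z)`). -/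
theorem sq_mul_norm_fderiv_newtonFar_le {C : ℝ}
    (hC : ∀ w : (EuclideanSpace ℝ (Fin 3)), ‖w‖ ^ 2 * ‖fderiv ℝ (newtonFar 1 2) w‖ ≤ C) {R : ℝ} (hR : 0 < R) (z : (EuclideanSpace ℝ (Fin 3))) :
    ‖z‖ ^ 2 * ‖fderiv ℝ (newtonFar R (2 * R)) z‖ ≤ C := by
  have hscale : newtonFar R (2 * R) = fun z : (EuclideanSpace ℝ (Fin 3)) => R⁻¹ • newtonFar 1 2 (R⁻¹ • z) := by
    have h := newtonFar_scale' hR 1 2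
    rwa [mul_one, mul_comm] at h
  have hdiff : Differentiable ℝ (newtonFar 1 2 : (EuclideanSpace ℝ (Fin 3)) → ℝ) :=
    (contDiff_newtonFar one_pos one_lt_two (n := 1)).differentiable one_ne_zero
  have hfd : fderiv ℝ (newtonFar R (2 * R)) z =
      R⁻¹ • (R⁻¹ • (fderiv ℝ (newtonFar 1 2) (R⁻¹ • z))) := by
    rw [hscale]
    have h1 : HasFDerivAt (fun z : (EuclideanSpace ℝ (Fin 3)) => R⁻¹ • z) (R⁻¹ • ContinuousLinearMap.id ℝ (EuclideanSpace ℝ (Fin 3))) z :=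
      (hasFDerivAt_id z).const_smul R⁻¹
    have h2 : HasFDerivAt (fun z : (EuclideanSpace ℝ (Fin 3)) => R⁻¹ • newtonFar 1 2 (R⁻¹ • z))
        (R⁻¹ • ((fderiv ℝ (newtonFar 1 2) (R⁻¹ • z)).comp (R⁻¹ • ContinuousLinearMap.id ℝ (EuclideanSpace ℝ (Fin 3))))) z :=
      ((hdiff (R⁻¹ • z)).hasFDerivAt.comp z h1).const_smul R⁻¹
    rw [h2.fderiv]
    ext v
    simp
  rw [hfd, norm_smul, norm_smul, norm_inv, Real.norm_eq_abs, abs_of_pos hR]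
  have h := hC (R⁻¹ • z)
  rw [norm_smul, norm_inv, Real.norm_eq_abs, abs_of_pos hR] at h
  calc ‖z‖ ^ 2 * (R⁻¹ * (R⁻¹ * ‖fderiv ℝ (newtonFar 1 2) (R⁻¹ • z)‖))
      = (R⁻¹ * ‖z‖) ^ 2 * ‖fderiv ℝ (newtonFar 1 2) (R⁻¹ • z)‖ := by ring
    _ ≤ C := h

/-- `DΓ∞^{R,2R}(z) = 0` inside the ball `|z| < R` (the far kernel vanishes there). -/
theorem fderiv_newtonFar_eq_zero_of_lt {R : ℝ} (hR : 0 < R) {z : (EuclideanSpace ℝ (Fin 3))} (hz : ‖z‖ < R) :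
    fderiv ℝ (newtonFar R (2 * R)) z = 0 := by
  have hev : newtonFar R (2 * R) =ᶠ[𝓝 z] fun _ => (0 : ℝ) :=
    newtonFar_eventuallyEq_zero hR.le (by linarith) hz
  rw [hev.fderiv_eq, fderiv_const_apply]

/-- the uniform derivative bound on the far kernel: `‖DΓ∞^{R,2R}(z)‖ ≤ C_Γ/R²` everywhere. -/
theorem norm_fderiv_newtonFar_le {C : ℝ} (hC0 : 0 ≤ C)
    (hC : ∀ w : (EuclideanSpace ℝ (Fin 3)), ‖w‖ ^ 2 * ‖fderiv ℝ (newtonFar 1 2) w‖ ≤ C) {R : ℝ} (hR : 0 < R) (z : (EuclideanSpace ℝ (Fin 3))) :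
    ‖fderiv ℝ (newtonFar R (2 * R)) z‖ ≤ C / R ^ 2 := by
  by_cases hz : ‖z‖ < R
  · rw [fderiv_newtonFar_eq_zero_of_lt hR hz, norm_zero]; positivity
  · rw [not_lt] at hz
    have hzpos : 0 < ‖z‖ := hR.trans_le hz
    have h := sq_mul_norm_fderiv_newtonFar_le hC hR z
    rw [le_div_iff₀ (by positivity)]
    calc ‖fderiv ℝ (newtonFar R (2 * R)) z‖ * R ^ 2
        ≤ ‖fderiv ℝ (newtonFar R (2 * R)) z‖ * ‖z‖ ^ 2 :=
          mul_le_mul_of_nonneg_left (pow_le_pow_left₀ hR.le hz 2) (norm_nonneg _)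
      _ ≤ C := by rw [mul_comm]; exact h

/-! ## §2 The telescoping kernel `K_R = Γ∞^{R,2R} − Γ∞^{2R,4R}` -/

/-- `K_R` is smooth. -/
theorem contDiff_shellKernel {R : ℝ} (hR : 0 < R) {n : ℕ∞} :
    ContDiff ℝ n (fun z : (EuclideanSpace ℝ (Fin 3)) => newtonFar R (2 * R) z - newtonFar (2 * R) (4 * R) z) :=
  (contDiff_newtonFar hR (by linarith)).sub (contDiff_newtonFar (by linarith) (by linarith))

/-- `K_R = 0` for `|z| ≥ 4R` (both far kernels equal `Γ` there). -/
theorem shellKernel_eq_zero_of_le {R : ℝ} (hR : 0 < R) {z : (EuclideanSpace ℝ (Fin 3))} (hz : 4 * R ≤ ‖z‖) :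
    newtonFar R (2 * R) z - newtonFar (2 * R) (4 * R) z = 0 := by
  rw [newtonFar_eq_newtonKernel hR.le (by linarith) (by linarith),
    newtonFar_eq_newtonKernel (by linarith) (by linarith) hz, sub_self]

/-- `K_R` has compact support (inside `|z| ≤ 4R`). -/
theorem hasCompactSupport_shellKernel {R : ℝ} (hR : 0 < R) :
    HasCompactSupport (fun z : (EuclideanSpace ℝ (Fin 3)) => newtonFar R (2 * R) z - newtonFar (2 * R) (4 * R) z) := by
  refine HasCompactSupport.intro (isCompact_closedBall (0 : (EuclideanSpace ℝ (Fin 3))) (4 * R)) fun z hz => ?_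
  rw [mem_closedBall_zero_iff, not_le] at hz
  exact shellKernel_eq_zero_of_le hR hz.le

/-- `DK_R = 0` outside `|z| ≤ 4R`. -/
theorem fderiv_shellKernel_eq_zero_of_lt {R : ℝ} (hR : 0 < R) {z : (EuclideanSpace ℝ (Fin 3))} (hz : 4 * R < ‖z‖) :
    fderiv ℝ (fun z : (EuclideanSpace ℝ (Fin 3)) => newtonFar R (2 * R) z - newtonFar (2 * R) (4 * R) z) z = 0 := by
  have hev : (fun z : (EuclideanSpace ℝ (Fin 3)) => newtonFar R (2 * R) z - newtonFar (2 * R) (4 * R) z) =ᶠ[𝓝 z]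
      fun _ => (0 : ℝ) := by
    have hopen : IsOpen {w : (EuclideanSpace ℝ (Fin 3)) | 4 * R < ‖w‖} := isOpen_lt continuous_const continuous_norm
    filter_upwards [hopen.mem_nhds hz] with w hw
    exact shellKernel_eq_zero_of_le hR (le_of_lt hw)
  rw [hev.fderiv_eq, fderiv_const_apply]

/-- `‖DK_R(z)‖ ≤ 2C_Γ/R²` everywhere. -/
theorem norm_fderiv_shellKernel_le {C : ℝ} (hC0 : 0 ≤ C)
    (hC : ∀ w : (EuclideanSpace ℝ (Fin 3)), ‖w‖ ^ 2 * ‖fderiv ℝ (newtonFar 1 2) w‖ ≤ C) {R : ℝ} (hR : 0 < R) (z : (EuclideanSpace ℝ (Fin 3))) :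
    ‖fderiv ℝ (fun z : (EuclideanSpace ℝ (Fin 3)) => newtonFar R (2 * R) z - newtonFar (2 * R) (4 * R) z) z‖ ≤ 2 * C / R ^ 2 := by
  have h1 : Differentiable ℝ (newtonFar R (2 * R) : (EuclideanSpace ℝ (Fin 3)) → ℝ) :=
    (contDiff_newtonFar hR (by linarith) (n := 1)).differentiable one_ne_zero
  have h2 : Differentiable ℝ (newtonFar (2 * R) (4 * R) : (EuclideanSpace ℝ (Fin 3)) → ℝ) :=
    (contDiff_newtonFar (by linarith) (by linarith) (n := 1)).differentiable one_ne_zero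
  have hsub : fderiv ℝ (fun z : (EuclideanSpace ℝ (Fin 3)) => newtonFar R (2 * R) z - newtonFar (2 * R) (4 * R) z) z =
      fderiv ℝ (newtonFar R (2 * R)) z - fderiv ℝ (newtonFar (2 * R) (4 * R)) z :=
    fderiv_fun_sub (h1 z) (h2 z)
  rw [hsub]
  have hb1 := norm_fderiv_newtonFar_le hC0 hC hR z
  have hb2 : ‖fderiv ℝ (newtonFar (2 * R) (4 * R)) z‖ ≤ C / (2 * R) ^ 2 := by
    have h := norm_fderiv_newtonFar_le hC0 hC (by linarith : 0 < 2 * R) z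
    rwa [show 2 * (2 * R) = 4 * R by ring] at h
  have hb2' : C / (2 * R) ^ 2 ≤ C / R ^ 2 :=
    div_le_div_of_nonneg_left hC0 (by positivity) (by nlinarith)
  calc ‖fderiv ℝ (newtonFar R (2 * R)) z - fderiv ℝ (newtonFar (2 * R) (4 * R)) z‖
      ≤ ‖fderiv ℝ (newtonFar R (2 * R)) z‖ + ‖fderiv ℝ (newtonFar (2 * R) (4 * R)) z‖ := norm_sub_le _ _
    _ ≤ C / R ^ 2 + C / R ^ 2 := add_le_add hb1 (hb2.trans hb2')
    _ = 2 * C / R ^ 2 := by ring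

/-- `ΔK_R = λ^{R,2R} − λ^{2R,4R}`. -/
theorem laplacian_shellKernel {R : ℝ} (hR : 0 < R) (z : (EuclideanSpace ℝ (Fin 3))) :
    (Δ (fun z : (EuclideanSpace ℝ (Fin 3)) => newtonFar R (2 * R) z - newtonFar (2 * R) (4 * R) z)) z =
      newtonFarLaplacian R (2 * R) z - newtonFarLaplacian (2 * R) (4 * R) z := by
  have h1 : ContDiff ℝ 2 (newtonFar R (2 * R) : (EuclideanSpace ℝ (Fin 3)) → ℝ) := contDiff_newtonFar hR (by linarith)
  have h2 : ContDiff ℝ 2 (newtonFar (2 * R) (4 * R) : (EuclideanSpace ℝ (Fin 3)) → ℝ) :=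
    contDiff_newtonFar (by linarith) (by linarith)
  have h := h1.contDiffAt.laplacian_sub h2.contDiffAt (x := z)
  rw [newtonFarLaplacian, newtonFarLaplacian, ← h]
  rfl

/-! ## §3 The telescoping identity and the `K/R` bound -/

/-- **Telescoping identity**: for `φ ∈ C²`, `∫ λ^{R,2R} φ − ∫ λ^{2R,4R} φ = ∫ K_R Δφ` (Green's second identity for the smooth
compactly supported `K_R`). -/
theorem shellMean_sub_shellMean_eq {R : ℝ} (hR : 0 < R) {φ : (EuclideanSpace ℝ (Fin 3)) → ℝ} (hφ : ContDiff ℝ 2 φ) :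
    (∫ z, newtonFarLaplacian R (2 * R) z * φ z) - (∫ z, newtonFarLaplacian (2 * R) (4 * R) z * φ z) =
      ∫ z, (newtonFar R (2 * R) z - newtonFar (2 * R) (4 * R) z) * (Δ φ) z := by
  have hK2 : ContDiff ℝ 2 (fun z : (EuclideanSpace ℝ (Fin 3)) => newtonFar R (2 * R) z - newtonFar (2 * R) (4 * R) z) :=
    contDiff_shellKernel hR
  rw [integral_mul_laplacian_comm hφ hK2 (hasCompactSupport_shellKernel hR)]
  have hi1 : Integrable fun z : (EuclideanSpace ℝ (Fin 3)) => newtonFarLaplacian R (2 * R) z * φ z :=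
    ((continuous_newtonFarLaplacian hR (by linarith)).mul hφ.continuous).integrable_of_hasCompactSupport
      ((hasCompactSupport_newtonFarLaplacian hR.le (by linarith)).mul_right)
  have hi2 : Integrable fun z : (EuclideanSpace ℝ (Fin 3)) => newtonFarLaplacian (2 * R) (4 * R) z * φ z :=
    ((continuous_newtonFarLaplacian (by linarith) (by linarith)).mul hφ.continuous).integrable_of_hasCompactSupport
      ((hasCompactSupport_newtonFarLaplacian (by linarith) (by linarith)).mul_right)
  rw [← integral_sub hi1 hi2]
  refine integral_congr_ae (Eventually.of_forall fun z => ?_)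
  simp only [laplacian_shellKernel hR z, sub_mul]

/-- For a gradient component `φ = ∂ₑP` the Laplacian is a derivative: `∫ K_R Δ(∂ₑP) = −∫ ∂ₑK_R · ΔP`. -/
theorem integral_shellKernel_mul_laplacian_fderiv {R : ℝ} (hR : 0 < R) {P : (EuclideanSpace ℝ (Fin 3)) → ℝ} (hP : ContDiff ℝ ∞ P) (e : (EuclideanSpace ℝ (Fin 3))) :
    ∫ z, (newtonFar R (2 * R) z - newtonFar (2 * R) (4 * R) z) * (Δ (fun y => fderiv ℝ P y e)) z =
      -∫ z, fderiv ℝ (fun z : (EuclideanSpace ℝ (Fin 3)) => newtonFar R (2 * R) z - newtonFar (2 * R) (4 * R) z) z e * (Δ P) z := by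
  set K : (EuclideanSpace ℝ (Fin 3)) → ℝ := fun z => newtonFar R (2 * R) z - newtonFar (2 * R) (4 * R) z with hKdef
  have hK : ContDiff ℝ 1 K := contDiff_shellKernel hR
  have hKc : HasCompactSupport K := hasCompactSupport_shellKernel hR
  have hP3 : ContDiff ℝ 3 P := hP.of_le (by norm_cast)
  have hΔP : ContDiff ℝ 1 (Δ P) := by
    have := contDiff_laplacian (f := P) (n := 1) (hP.of_le (by norm_cast))
    exact this
  -- `Δ ∂ₑP = ∂ₑ ΔP`
  have hcomm : ∀ z, (Δ (fun y => fderiv ℝ P y e)) z = fderiv ℝ (Δ P) z e := fun z =>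
    (fderiv_laplacian_apply hP3 z e).symm
  simp_rw [hcomm]
  -- integrate `∂ₑ (K · ΔP) = ∂ₑK · ΔP + K · ∂ₑ ΔP` over `ℝ³`
  have hprod : ContDiff ℝ 1 fun z => K z * (Δ P) z := hK.mul hΔP
  have hzero := integral_fderiv_apply_eq_zero hprod hKc.mul_right e
  have hderiv : ∀ z, fderiv ℝ (fun z => K z * (Δ P) z) z e =
      fderiv ℝ K z e * (Δ P) z + K z * fderiv ℝ (Δ P) z e := by
    intro z
    rw [fderiv_fun_mul ((hK.differentiable one_ne_zero) z) ((hΔP.differentiable one_ne_zero) z)]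
    simp only [FunLike.coe_add, FunLike.coe_smul, Pi.add_apply, Pi.smul_apply, smul_eq_mul]
    ring
  simp_rw [hderiv] at hzero
  have hi1 : Integrable fun z => fderiv ℝ K z e * (Δ P) z :=
    (((hK.continuous_fderiv one_ne_zero).clm_apply continuous_const).mul hΔP.continuous).integrable_of_hasCompactSupport
      ((hKc.fderiv_apply (𝕜 := ℝ) e).mul_right)
  have hi2 : Integrable fun z => K z * fderiv ℝ (Δ P) z e :=
    (hK.continuous.mul ((hΔP.continuous_fderiv one_ne_zero).clm_apply continuous_const)).integrable_of_hasCompactSupport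
      hKc.mul_right
  rw [integral_add hi1 hi2] at hzero
  linarith

/-- volume of a closed ball in `ℝ³` as a real number: `|B̄(0,r)| = r³ |B̄(0,1)|`. -/
theorem volumeReal_closedBall_eq {r : ℝ} (hr : 0 ≤ r) :
    (volume (closedBall (0 : (EuclideanSpace ℝ (Fin 3))) r)).toReal = r ^ 3 * (volume (ball (0 : (EuclideanSpace ℝ (Fin 3))) 1)).toReal := by
  rw [Measure.addHaar_closedBall volume _ hr, finrank_euclideanSpace_fin, ENNReal.toReal_mul,
    ENNReal.toReal_ofReal (by positivity)]

/-- **The `K/R` bound**: if `|ΔP(z)| ≤ K/|z|²` for `|z| ≥ R₁` then, for `R ≥ R₁`,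
`|∫ ∂ₑK_R · ΔP| ≤ (128 |B₁| C_Γ) · ‖e‖ · K / R`. -/
theorem abs_integral_fderiv_shellKernel_mul_le {C : ℝ} (hC0 : 0 ≤ C)
    (hC : ∀ w : (EuclideanSpace ℝ (Fin 3)), ‖w‖ ^ 2 * ‖fderiv ℝ (newtonFar 1 2) w‖ ≤ C)
    {P : (EuclideanSpace ℝ (Fin 3)) → ℝ} {K R₁ : ℝ} (hK : 0 ≤ K) (hR₁ : 0 < R₁)
    (hΔ : ∀ z : (EuclideanSpace ℝ (Fin 3)), R₁ ≤ ‖z‖ → |(Δ P) z| ≤ K / ‖z‖ ^ 2) {R : ℝ} (hR : R₁ ≤ R) (e : (EuclideanSpace ℝ (Fin 3))) :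
    |∫ z, fderiv ℝ (fun z : (EuclideanSpace ℝ (Fin 3)) => newtonFar R (2 * R) z - newtonFar (2 * R) (4 * R) z) z e * (Δ P) z| ≤
      (128 * (volume (ball (0 : (EuclideanSpace ℝ (Fin 3))) 1)).toReal * C) * ‖e‖ * K / R := by
  have hRpos : 0 < R := hR₁.trans_le hR
  set K' : (EuclideanSpace ℝ (Fin 3)) → ℝ := fun z => newtonFar R (2 * R) z - newtonFar (2 * R) (4 * R) z with hKdef
  -- pointwise bound by a constant times the indicator of `B̄(0, 4R)`
  set M : ℝ := (2 * C / R ^ 2) * ‖e‖ * (K / R ^ 2) with hMdef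
  have hM0 : 0 ≤ M := by positivity
  have hpt : ∀ z, ‖fderiv ℝ K' z e * (Δ P) z‖ ≤ (closedBall (0 : (EuclideanSpace ℝ (Fin 3))) (4 * R)).indicator (fun _ => M) z := by
    intro z
    by_cases hz4 : 4 * R < ‖z‖
    · rw [fderiv_shellKernel_eq_zero_of_lt hRpos hz4]
      simpa using Set.indicator_nonneg (fun _ _ => hM0) _
    · rw [not_lt] at hz4
      rw [Set.indicator_of_mem (mem_closedBall_zero_iff.2 hz4)]
      by_cases hzR : ‖z‖ < R
      · have h1 : Differentiable ℝ (newtonFar R (2 * R) : (EuclideanSpace ℝ (Fin 3)) → ℝ) :=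
          (contDiff_newtonFar hRpos (by linarith) (n := 1)).differentiable one_ne_zero
        have h2 : Differentiable ℝ (newtonFar (2 * R) (4 * R) : (EuclideanSpace ℝ (Fin 3)) → ℝ) :=
          (contDiff_newtonFar (by linarith) (by linarith) (n := 1)).differentiable one_ne_zero
        have : fderiv ℝ K' z = 0 := by
          rw [hKdef, fderiv_fun_sub (h1 z) (h2 z), fderiv_newtonFar_eq_zero_of_lt hRpos hzR]
          have h' := fderiv_newtonFar_eq_zero_of_lt (R := 2 * R) (by linarith) (z := z) (by linarith)
          rw [show 2 * (2 * R) = 4 * R by ring] at h'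
          rw [h', sub_zero]
        rw [this]
        simpa using hM0
      · rw [not_lt] at hzR
        have hzpos : 0 < ‖z‖ := hRpos.trans_le hzR
        have hD : ‖fderiv ℝ K' z e‖ ≤ 2 * C / R ^ 2 * ‖e‖ :=
          (ContinuousLinearMap.le_opNorm _ _).trans
            (mul_le_mul_of_nonneg_right (norm_fderiv_shellKernel_le hC0 hC hRpos z) (norm_nonneg _))
        have hf : |(Δ P) z| ≤ K / R ^ 2 :=
          (hΔ z (hR.trans hzR)).trans (div_le_div_of_nonneg_left hK (by positivity)
            (pow_le_pow_left₀ hRpos.le hzR 2))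
        have hf' : ‖(Δ P) z‖ ≤ K / R ^ 2 := by rw [Real.norm_eq_abs]; exact hf
        rw [norm_mul]
        exact mul_le_mul hD hf' (norm_nonneg _) (by positivity)
  have hint : Integrable (fun z : (EuclideanSpace ℝ (Fin 3)) => (closedBall (0 : (EuclideanSpace ℝ (Fin 3))) (4 * R)).indicator (fun _ => M) z) :=
    (integrableOn_const (measure_closedBall_lt_top.ne)).integrable_indicator measurableSet_closedBall
  calc |∫ z, fderiv ℝ K' z e * (Δ P) z|
      = ‖∫ z, fderiv ℝ K' z e * (Δ P) z‖ := (Real.norm_eq_abs _).symm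
    _ ≤ ∫ z, (closedBall (0 : (EuclideanSpace ℝ (Fin 3))) (4 * R)).indicator (fun _ => M) z :=
        norm_integral_le_of_norm_le hint (Eventually.of_forall hpt)
    _ = M * (volume (closedBall (0 : (EuclideanSpace ℝ (Fin 3))) (4 * R))).toReal := by
        rw [integral_indicator measurableSet_closedBall, setIntegral_const, smul_eq_mul, mul_comm]
        rfl
    _ = (128 * (volume (ball (0 : (EuclideanSpace ℝ (Fin 3))) 1)).toReal * C) * ‖e‖ * K / R := by
        rw [volumeReal_closedBall_eq (by positivity : (0 : ℝ) ≤ 4 * R), hMdef]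
        field_simp
        ring

/-- **Shell means of a gradient component are dyadically Cauchy.**  If `P ∈ C^∞(ℝ³)` has `|ΔP(z)| ≤ K/|z|²` for `|z| ≥ R₁ > 0`,
then for every `R ≥ R₁` and direction `e`:
`|∫ λ^{R,2R} ∂ₑP − ∫ λ^{2R,4R} ∂ₑP| ≤ C₀ · C_Γ · ‖e‖ · K / R` with the absolute `C₀ = 128 |B₁|`. -/
theorem shellMean_sub_shellMean_le {C : ℝ} (hC0 : 0 ≤ C)
    (hC : ∀ w : (EuclideanSpace ℝ (Fin 3)), ‖w‖ ^ 2 * ‖fderiv ℝ (newtonFar 1 2) w‖ ≤ C)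
    {P : (EuclideanSpace ℝ (Fin 3)) → ℝ} (hP : ContDiff ℝ ∞ P) {K R₁ : ℝ} (hK : 0 ≤ K) (hR₁ : 0 < R₁)
    (hΔ : ∀ z : (EuclideanSpace ℝ (Fin 3)), R₁ ≤ ‖z‖ → |(Δ P) z| ≤ K / ‖z‖ ^ 2) {R : ℝ} (hR : R₁ ≤ R) (e : (EuclideanSpace ℝ (Fin 3))) :
    |(∫ z, newtonFarLaplacian R (2 * R) z * fderiv ℝ P z e) -
        (∫ z, newtonFarLaplacian (2 * R) (4 * R) z * fderiv ℝ P z e)| ≤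
      (128 * (volume (ball (0 : (EuclideanSpace ℝ (Fin 3))) 1)).toReal * C) * ‖e‖ * K / R := by
  have hRpos : 0 < R := hR₁.trans_le hR
  have hφ : ContDiff ℝ 2 (fun y : (EuclideanSpace ℝ (Fin 3)) => fderiv ℝ P y e) :=
    (hP.fderiv_right (m := 2) (by norm_cast)).clm_apply contDiff_const
  rw [shellMean_sub_shellMean_eq hRpos hφ, integral_shellKernel_mul_laplacian_fderiv hRpos hP e, abs_neg]
  exact abs_integral_fderiv_shellKernel_mul_le hC0 hC hK hR₁ hΔ hR e

/-! ## §4 The shell mean against a value: oscillation bound -/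

/-- `∫ |λ^{R,2R}|` does not depend on `R`. -/
theorem integral_abs_newtonFarLaplacian_dyadic {R : ℝ} (hR : 0 < R) :
    ∫ z : (EuclideanSpace ℝ (Fin 3)), |newtonFarLaplacian R (2 * R) z| = ∫ w : (EuclideanSpace ℝ (Fin 3)), |newtonFarLaplacian 1 2 w| := by
  have h := integral_abs_newtonFarLaplacian_scale hR 1 2
  rwa [mul_one, mul_comm] at h

/-- **Shell mean vs. a value**: for continuous `φ` and any `v`, if `|φ z − v| ≤ δ` on the shell `R ≤ |z| ≤ 2R`, then
`|∫ λ^{R,2R} φ − v| ≤ (∫|λ^{1,2}|) · δ` (mass one, support in the shell). -/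
theorem abs_shellMean_sub_le {R : ℝ} (hR : 0 < R) {φ : (EuclideanSpace ℝ (Fin 3)) → ℝ} (hφ : Continuous φ) {v δ : ℝ}
    (hosc : ∀ z : (EuclideanSpace ℝ (Fin 3)), R ≤ ‖z‖ → ‖z‖ ≤ 2 * R → |φ z - v| ≤ δ) :
    |(∫ z, newtonFarLaplacian R (2 * R) z * φ z) - v| ≤ (∫ w : (EuclideanSpace ℝ (Fin 3)), |newtonFarLaplacian 1 2 w|) * δ := by
  have h2R : R < 2 * R := by linarith
  set lam := newtonFarLaplacian R (2 * R) with hlam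
  have hlc : Continuous lam := continuous_newtonFarLaplacian hR h2R
  have hls : HasCompactSupport lam := hasCompactSupport_newtonFarLaplacian hR.le h2R
  have hmass : ∫ z, lam z = 1 := integral_newtonFarLaplacian hR h2R
  have hi1 : Integrable fun z => lam z * φ z := (hlc.mul hφ).integrable_of_hasCompactSupport hls.mul_right
  have hi0 : Integrable lam := hlc.integrable_of_hasCompactSupport hls
  have hrepr : (∫ z, lam z * φ z) - v = ∫ z, lam z * (φ z - v) := by
    simp_rw [mul_sub]
    rw [integral_sub hi1 (hi0.mul_const v), integral_mul_const, hmass, one_mul]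
  rw [hrepr]
  have hpt : ∀ z, ‖lam z * (φ z - v)‖ ≤ |lam z| * δ := by
    intro z
    rw [norm_mul, Real.norm_eq_abs, Real.norm_eq_abs]
    by_cases hz : R ≤ ‖z‖ ∧ ‖z‖ ≤ 2 * R
    · exact mul_le_mul_of_nonneg_left (hosc z hz.1 hz.2) (abs_nonneg _)
    · have : lam z = 0 := by
        rcases not_and_or.1 hz with h | h
        · exact newtonFarLaplacian_eq_zero_of_lt hR.le h2R (not_le.1 h)
        · exact newtonFarLaplacian_eq_zero_of_gt hR.le h2R (not_le.1 h)
      rw [this, abs_zero, zero_mul, zero_mul]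
  calc |∫ z, lam z * (φ z - v)| = ‖∫ z, lam z * (φ z - v)‖ := (Real.norm_eq_abs _).symm
    _ ≤ ∫ z, |lam z| * δ := norm_integral_le_of_norm_le (hi0.abs.mul_const δ) (Eventually.of_forall hpt)
    _ = (∫ w : (EuclideanSpace ℝ (Fin 3)), |newtonFarLaplacian 1 2 w|) * δ := by
        rw [integral_mul_const, hlam, integral_abs_newtonFarLaplacian_dyadic hR]

end Summit.NavierStokesRegularity.NavierStokesRegularity.Theorems.CoriolisHead

end
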